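import Summits.ResolutionOfSingularities.ResolutionOfSingularities.Theorems.FrobeniusClosingPatchingRelPerfectCoreRungTowerEuclidRungs
import Summits.ResolutionOfSingularities.ResolutionOfSingularities.Theorems.FrobeniusClosingPatchingRelPerfectCoreRungTowerPowers
import HarnessLib

/-!
# Crux `PatchingRelPerfect` (stmt-ResolutionOfSingularities-16161), chain w52 — CORE RUNG r1τ,
# part 9: monomial complete intersections with ANY TWO EXPONENTS `{a, b}`

[OURS · L1 W5.2 · rung r1τ] With the Euclidean rung `(z)ᵃ + 𝔪ᵇ ∈ 𝒞` (all `a ≤ b`,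
`…CoreRungTowerEuclidRungs.lean`) the monomial complete intersections
`I = (z₁ᵃ, …, z_mᵃ, y₁ᵇ, …, y_eᵇ)` follow by stub-2's closure of `𝒞` under reductions once
`I` is shown to be a reduction of `K = (z)ᵃ + 𝔪ᵇ`: a TWO-BLOCK PIGEONHOLE
(`CoreRungTower.twoBlock_mul_pow_eq`): every block `P^{ai+k} Y^{b(r+1-i)-k}` of `Kʳ⁺¹`
(`P = (z)`, `Y = (y)`) has either enough `z`'s to contain some `zⱼᵃ` or enough `y`'s to contain
some `yₖᵇ` (r1a's one-block pigeonhole), with cofactor in `Kʳ`, as soon as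
`r ≥ 2m(a−1) + e(b−1) + b + 1`.  PROVED, every regular local `S` of every dimension:

* `CoreRungTower.mul_pow_sup_le` (binomial estimate with a left factor),
  `CoreRungTower.twoBlock_mul_pow_eq` — `I · Kʳ = Kʳ⁺¹` (any commutative ring, `1 ≤ a ≤ b`);
* `companion_monomialCI_two_exponents`, `coreRung_monomialCI_two_exponents`,
  `atomDimFourBlowupAt_monomialCI_two_exponents` — `(z₁ᵃ, …, z_mᵃ, y₁ᵇ, …, y_eᵇ) ∈ 𝒞`, ALL
  `1 ≤ a ≤ b`: in dimension `4` every `(x₁^{a₁}, …, x₄^{a₄})` whose exponents take at most TWO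
  values (after ordering the basis so that the smaller exponent comes first).

Three or more distinct exponents need the general toric fan; not attempted.  FORMAT evidence for
the core (CHAIN §1 (A)); nothing here is a statement of the manuscript under review.

## References

* The Stacks Project, Tag 080A. [StacksProject]
* I. Swanson, C. Huneke, *Integral Closure of Ideals, Rings, and Modules*, CUP 2006, §1.4, §8.1
  (monomial reductions, Newton polyhedra). [HunekeSwanson2006]
-/

-- `Summit.<Summit>.<Sub>.Theorems` with `Sub = Summit` (single-conjunct summit, D-0017)
set_option linter.dupNamespace false

noncomputable section

open CategoryTheory CategoryTheory.Limits AlgebraicGeometry Literature.AlgebraicGeometry.Resolution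
open Summit.ResolutionOfSingularities.ResolutionOfSingularities.Theorems.CoreRungTower

namespace Summit.ResolutionOfSingularities.ResolutionOfSingularities.Theorems

universe u

namespace CoreRungTower

/-- **`A · (P + Q)ⁿ ⊆ T` as soon as `A · Pᵏ · Qⁿ⁻ᵏ ⊆ T` for all `k ≤ n`.** [folklore] -/
theorem mul_pow_sup_le {R : Type*} [CommSemiring R] {A P Q T : Ideal R} {n : ℕ}
    (h : ∀ k, k ≤ n → A * (P ^ k * Q ^ (n - k)) ≤ T) : A * (P ⊔ Q) ^ n ≤ T := by
  rw [← Ideal.add_eq_sup, add_pow, Finset.mul_sum]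
  refine Finset.sum_induction _ (fun I : Ideal R => I ≤ T) (fun I J hI hJ => ?_) ?_ ?_
  · rw [Ideal.add_eq_sup]
    exact sup_le hI hJ
  · rw [Ideal.zero_eq_bot]
    exact bot_le
  · intro k hk
    rw [← mul_assoc]
    exact Ideal.mul_le_right.trans (h k (Nat.lt_succ_iff.mp (Finset.mem_range.mp hk)))

/-- **Two-block pigeonhole.** For families `z = (z₁, …, z_m)`, `y = (y₁, …, y_e)` in a commutative
ring, `1 ≤ a ≤ b`, `P = (z)`, `Y = (y)`, `K = Pᵃ + (P + Y)ᵇ` and `I = (zⱼᵃ)_j + (yₖᵇ)_k`: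
`I · Kʳ = Kʳ⁺¹` for every `r ≥ 2m(a−1) + e(b−1) + b + 1` — `I` is a reduction of `K`.
[cite: HunekeSwanson2006, §8.1] -/
theorem twoBlock_mul_pow_eq {R : Type*} [CommRing R] {m e : ℕ} (z : Fin m → R) (y : Fin e → R)
    {a b r : ℕ} (ha : 1 ≤ a) (hab : a ≤ b) (hr : 2 * (m * (a - 1)) + e * (b - 1) + b + 1 ≤ r) :
    (Ideal.span (Set.range fun j => z j ^ a) ⊔ Ideal.span (Set.range fun k => y k ^ b)) *
        (Ideal.span (Set.range z) ^ a ⊔ (Ideal.span (Set.range z) ⊔ Ideal.span (Set.range y)) ^ b) ^ r =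
      (Ideal.span (Set.range z) ^ a ⊔ (Ideal.span (Set.range z) ⊔ Ideal.span (Set.range y)) ^ b) ^
        (r + 1) := by
  -- abbreviations (as hypotheses, to keep rewriting predictable)
  obtain ⟨P, hP⟩ : ∃ P : Ideal R, P = Ideal.span (Set.range z) := ⟨_, rfl⟩
  obtain ⟨Y, hY⟩ : ∃ Y : Ideal R, Y = Ideal.span (Set.range y) := ⟨_, rfl⟩
  obtain ⟨Za, hZa⟩ : ∃ Za : Ideal R, Za = Ideal.span (Set.range fun j => z j ^ a) := ⟨_, rfl⟩
  obtain ⟨Yb, hYb⟩ : ∃ Yb : Ideal R, Yb = Ideal.span (Set.range fun k => y k ^ b) := ⟨_, rfl⟩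
  rw [← hP, ← hY, ← hZa, ← hYb]
  obtain ⟨K, hK⟩ : ∃ K : Ideal R, K = P ^ a ⊔ (P ⊔ Y) ^ b := ⟨_, rfl⟩
  rw [← hK]
  have hZaP : Za ≤ P ^ a := by
    rw [hZa, hP, Ideal.span_le]; rintro _ ⟨j, rfl⟩
    exact Ideal.pow_mem_pow (Ideal.subset_span (Set.mem_range_self j)) a
  have hYbY : Yb ≤ Y ^ b := by
    rw [hYb, hY, Ideal.span_le]; rintro _ ⟨k, rfl⟩
    exact Ideal.pow_mem_pow (Ideal.subset_span (Set.mem_range_self k)) b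
  have hIK : Za ⊔ Yb ≤ K := by
    rw [hK]
    exact sup_le (hZaP.trans le_sup_left)
      (hYbY.trans ((Ideal.pow_right_mono le_sup_right b).trans le_sup_right))
  -- one-block pigeonholes (r1a)
  have hZpig : ∀ N, m * (a - 1) < a + N → P ^ (a + N) ≤ Za * P ^ N := fun N hN => by
    rw [hP, hZa]; exact CoreRung.span_pow_le_span_powers_mul_pow z hN
  have hYpig : ∀ N, e * (b - 1) < b + N → Y ^ (b + N) ≤ Yb * Y ^ N := fun N hN => by
    rw [hY, hYb]; exact CoreRung.span_pow_le_span_powers_mul_pow y hN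
  -- comparison with `K`
  have hMK : ∀ c, (P ⊔ Y) ^ (b * c) ≤ K ^ c := fun c => by
    rw [pow_mul, hK]; exact Ideal.pow_right_mono le_sup_right c
  have hPaK : ∀ i, P ^ (a * i) ≤ K ^ i := fun i => by
    rw [pow_mul, hK]; exact Ideal.pow_right_mono le_sup_left i
  have hPY : ∀ n₁ n₂, P ^ n₁ * Y ^ n₂ ≤ (P ⊔ Y) ^ (n₁ + n₂) := fun n₁ n₂ => by
    rw [pow_add]
    exact Ideal.mul_mono (Ideal.pow_right_mono le_sup_left _) (Ideal.pow_right_mono le_sup_right _)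
  have hb1 : 1 ≤ b := ha.trans hab
  apply le_antisymm
  · rw [pow_succ']
    exact Ideal.mul_mono_left hIK
  -- `Kʳ⁺¹ ⊆ I · Kʳ`
  rw [hK]
  refine pow_sup_le fun i hi => ?_
  rw [← pow_mul, ← pow_mul, ← hK]
  refine mul_pow_sup_le fun k hk => ?_
  rw [← mul_assoc, ← pow_add]
  -- the block `P^{ai+k} · Y^{b(r+1-i)-k}`
  by_cases hZ : m * (a - 1) < a * i + k
  · -- enough `z`'s
    by_cases hm : m = 0
    · -- no `z`'s at all: `P = 0` and the block vanishes
      subst hm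
      have hP0 : P = ⊥ := by rw [hP, Ideal.span_eq_bot]; rintro _ ⟨j, _⟩; exact j.elim0
      have hpos : a * i + k ≠ 0 := by omega
      rw [hP0, ← Ideal.zero_eq_bot, zero_pow hpos, zero_mul]
      exact bot_le
    · have ham : a - 1 ≤ m * (a - 1) := Nat.le_mul_of_pos_left _ (Nat.pos_of_ne_zero hm)
      obtain ⟨N, hN⟩ : ∃ N, a * i + k = a + N := ⟨a * i + k - a, by omega⟩
      rw [hN]
      calc P ^ (a + N) * Y ^ (b * (r + 1 - i) - k)
          ≤ (Za * P ^ N) * Y ^ (b * (r + 1 - i) - k) := Ideal.mul_mono_left (hZpig N (by omega))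
        _ = Za * (P ^ N * Y ^ (b * (r + 1 - i) - k)) := mul_assoc _ _ _
        _ ≤ (Za ⊔ Yb) * K ^ r := Ideal.mul_mono le_sup_left ?_
      -- the cofactor lies in `Kʳ`
      rcases Nat.eq_zero_or_pos i with rfl | hipos
      · -- `i = 0`: a monomial of total degree `≥ b r`
        simp only [Nat.sub_zero, Nat.mul_zero, Nat.zero_add] at hk hN ⊢
        have hbr : b * (r + 1) = b * r + b := Nat.mul_succ b r
        have hka : a ≤ k := by omega
        calc P ^ N * Y ^ (b * (r + 1) - k) ≤ (P ⊔ Y) ^ (N + (b * (r + 1) - k)) := hPY _ _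
          _ ≤ (P ⊔ Y) ^ (b * r) := Ideal.pow_le_pow_right (by omega)
          _ ≤ K ^ r := hMK r
      · -- `i ≥ 1`: `P^{a(i-1)} · (a monomial of total degree b c)`
        have hai : a * i = a * (i - 1) + a := by
          rw [show i = (i - 1) + 1 by omega, Nat.mul_succ]; rfl
        have hNk : N = a * (i - 1) + k := by omega
        rw [hNk, pow_add, mul_assoc]
        calc P ^ (a * (i - 1)) * (P ^ k * Y ^ (b * (r + 1 - i) - k))
            ≤ K ^ (i - 1) * (P ⊔ Y) ^ (k + (b * (r + 1 - i) - k)) :=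
              Ideal.mul_mono (hPaK _) (hPY _ _)
          _ ≤ K ^ (i - 1) * K ^ (r + 1 - i) := by
              refine Ideal.mul_mono_right ((Ideal.pow_le_pow_right ?_).trans (hMK _))
              omega
          _ = K ^ r := by rw [← pow_add]; congr 1; omega
  · -- enough `y`'s
    rw [not_lt] at hZ
    have hai : i ≤ a * i := Nat.le_mul_of_pos_left i ha
    have hile : i ≤ m * (a - 1) := hai.trans ((Nat.le_add_right _ _).trans hZ)
    have hkle : k ≤ m * (a - 1) := (Nat.le_add_left _ _).trans hZ
    have hc : b * (r + 1 - i) ≥ r + 1 - i := Nat.le_mul_of_pos_left _ hb1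
    have hc1 : b * (r + 1 - i) = b * (r - i) + b := by
      rw [show r + 1 - i = (r - i) + 1 by omega, Nat.mul_succ]
    obtain ⟨N, hN⟩ : ∃ N, b * (r + 1 - i) - k = b + N := ⟨b * (r + 1 - i) - k - b, by omega⟩
    rw [hN]
    calc P ^ (a * i + k) * Y ^ (b + N) ≤ P ^ (a * i + k) * (Yb * Y ^ N) :=
          Ideal.mul_mono_right (hYpig N (by omega))
      _ = Yb * (P ^ (a * i + k) * Y ^ N) := by ring
      _ ≤ (Za ⊔ Yb) * K ^ r := Ideal.mul_mono le_sup_right ?_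
    rw [pow_add, mul_assoc]
    calc P ^ (a * i) * (P ^ k * Y ^ N) ≤ K ^ i * (P ⊔ Y) ^ (k + N) :=
          Ideal.mul_mono (hPaK _) (hPY _ _)
      _ ≤ K ^ i * K ^ (r - i) := by
          refine Ideal.mul_mono_right ((Ideal.pow_le_pow_right ?_).trans (hMK _))
          omega
      _ = K ^ r := by rw [← pow_add]; congr 1; omega

end CoreRungTower

/-! ## The rung: monomial complete intersections with two exponents -/

section TwoExponents

variable {S : Type u} [CommRing S] [IsRegularLocalRing S] {m e : ℕ} (x : Fin (m + e) → S)
  (hx : Ideal.span (Set.range x) = IsLocalRing.maximalIdeal S)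
  (hd : (IsLocalRing.maximalIdeal S).spanFinrank = m + e)

include hx hd in
/-- **Monomial complete intersections with exponents `{a, b}` are in `𝒞`** (`1 ≤ a ≤ b`): for a
regular system of parameters `x = (z₁, …, z_m, y₁, …, y_e)`, `I = (z₁ᵃ, …, z_mᵃ, y₁ᵇ, …, y_eᵇ)`
is a reduction of `(z)ᵃ + 𝔪ᵇ ∈ 𝒞` (two-block pigeonhole + the Euclidean rung), hence has an
`𝔪`-primary companion with regular blowing up. [cite: StacksProject, Tag 080A]
[cite: HunekeSwanson2006, §8.1] -/
theorem companion_monomialCI_two_exponents (a b : ℕ) (ha : 1 ≤ a) (hab : a ≤ b) :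
    ∃ (Q : Ideal S) (m' : ℕ), IsLocalRing.maximalIdeal S ^ m' ≤ Q ∧
      ∃ (B : Scheme.{u}) (b' : B ⟶ Spec (.of S)),
        IsBlowup b' (affineBlowup.idealSheaf
          ((Ideal.span (Set.range fun j : Fin m => x (Fin.castAdd e j) ^ a) ⊔
            Ideal.span (Set.range fun k : Fin e => x (Fin.natAdd m k) ^ b)) * Q)) ∧
        Scheme.IsRegular B := by
  have hzy := CoreRungMonomialCI.span_castAdd_sup_span_natAdd x hx
  obtain ⟨β, rfl⟩ : ∃ β, b = a + β := ⟨b - a, by omega⟩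
  have hC := companion_pow_span_castAdd_sup_pow_maximalIdeal_add x hx hd a β
  have hred := twoBlock_mul_pow_eq (fun j : Fin m => x (Fin.castAdd e j))
    (fun k : Fin e => x (Fin.natAdd m k)) ha hab
    (le_refl (2 * (m * (a - 1)) + e * (a + β - 1) + (a + β) + 1))
  rw [hzy] at hred
  exact companion_of_reduction le_sup_right hred hC

include hx hd in
/-- **CORE RUNG r1τ — monomial complete intersections with two exponents.** For a regular local
`S` with regular system of parameters `x = (z₁, …, z_m, y₁, …, y_e)`, `1 ≤ a ≤ b`, and
`I = (z₁ᵃ, …, z_mᵃ, y₁ᵇ, …, y_eᵇ) ≠ 0`, every blowing up `f : T ⟶ Spec S` along `I` satisfies the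
conclusion of the blow-up-form open core `AtomDimFourBlowupAt`.  In dimension `4`: every
`(x₁^{a₁}, …, x₄^{a₄})` with at most two distinct exponents.  Every dimension, every regular local
base; FORMAT evidence for the core on this toric stratum. [cite: StacksProject, Tag 080A] -/
theorem coreRung_monomialCI_two_exponents (a b : ℕ) (ha : 1 ≤ a) (hab : a ≤ b)
    (hI : Ideal.span (Set.range fun j : Fin m => x (Fin.castAdd e j) ^ a) ⊔
      Ideal.span (Set.range fun k : Fin e => x (Fin.natAdd m k) ^ b) ≠ ⊥)
    (T : Scheme.{u}) (f : T ⟶ Spec (.of S))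
    (hf : IsBlowup f (affineBlowup.idealSheaf
      (Ideal.span (Set.range fun j : Fin m => x (Fin.castAdd e j) ^ a) ⊔
        Ideal.span (Set.range fun k : Fin e => x (Fin.natAdd m k) ^ b)))) :
    ∃ (J : T.IdealSheafData) (T' : Scheme.{u}) (π : T' ⟶ T), J ≠ ⊥ ∧
      (∀ t : T, t ∈ J.support → f.base t = IsLocalRing.closedPoint S) ∧
      IsBlowup π J ∧ Scheme.IsRegular T' :=
  atomConclusion_of_companion' hI (companion_monomialCI_two_exponents x hx hd a b ha hab) T f hf

end TwoExponents

/-- **The registered core's binder shape, restricted to the monomial complete intersections with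
two exponents** (hypotheses of `stub_atomDimFourBlowup`; dimension, characteristic, completeness,
residue field and the off-fibre hypothesis unused). [cite: StacksProject, Tag 080A] -/
theorem atomDimFourBlowupAt_monomialCI_two_exponents (p : ℕ) (_hp : p.Prime) (S : Type)
    [CommRing S] [IsRegularLocalRing S] [CharP S p]
    [IsAdicComplete (IsLocalRing.maximalIdeal S) S]
    [PerfectField (IsLocalRing.ResidueField S)] (_hS : ringKrullDim S = (4 : ℕ))
    {m e : ℕ} (x : Fin (m + e) → S)
    (hx : Ideal.span (Set.range x) = IsLocalRing.maximalIdeal S)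
    (hd : (IsLocalRing.maximalIdeal S).spanFinrank = m + e) (a b : ℕ) (ha : 1 ≤ a) (hab : a ≤ b)
    (hI : Ideal.span (Set.range fun j : Fin m => x (Fin.castAdd e j) ^ a) ⊔
      Ideal.span (Set.range fun k : Fin e => x (Fin.natAdd m k) ^ b) ≠ ⊥)
    (T : Scheme.{0}) (f : T ⟶ Spec (.of S))
    (hf : IsBlowup f (affineBlowup.idealSheaf
      (Ideal.span (Set.range fun j : Fin m => x (Fin.castAdd e j) ^ a) ⊔
        Ideal.span (Set.range fun k : Fin e => x (Fin.natAdd m k) ^ b))))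
    (_hoff : ∀ t : T, f.base t ≠ IsLocalRing.closedPoint S →
      IsRegularLocalRing (T.presheaf.stalk t)) :
    ∃ (J : T.IdealSheafData) (T' : Scheme.{0}) (π : T' ⟶ T), J ≠ ⊥ ∧
      (∀ t : T, t ∈ J.support → f.base t = IsLocalRing.closedPoint S) ∧
      IsBlowup π J ∧ Scheme.IsRegular T' :=
  coreRung_monomialCI_two_exponents x hx hd a b ha hab hI T f hf

end Summit.ResolutionOfSingularities.ResolutionOfSingularities.Theorems

end
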